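import Summits.BirchSwinnertonDyer.BirchSwinnertonDyer.Theorems.CumulativeHeegnerLeopoldtCumulativeHeegnerInclusionAtThreeSpecialisationValues
import Summits.BirchSwinnertonDyer.BirchSwinnertonDyer.Theorems.CumulativeHeegnerLeopoldtCumulativeHeegnerInclusionAtThreeUnrSeriesTemperedDomination
import Mathlib.Analysis.Normed.Group.FunctionSeries
import HarnessLib

/-!
# Crux K1 `CumulativeHeegnerInclusionAtThree` (stmt-BirchSwinnertonDyer-24198), line `birth`, stub A (= crux 26896):
# the TEMPERED index-currency transfer — radius-dependent constants at the INTERIOR height-one primes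

Lead seat bsd-line-chl-k1-p1 g5 (`--supports stmt-BirchSwinnertonDyer-24198`). The honest research residue of a tempered A-line
(memo TEMPERED-LINE-VIABILITY-g4 §2 (d♮)) is a Kolyvagin-system bound «prime by prime at INTERIOR height-one primes, with
ρ-dependent rescaling»: at a distinguished irreducible `Q` whose root `y` lies in the closed ball `‖y‖ ≤ ρ < 1`, the Selmer
index `#(X ⧸ Q X)` is bounded by `L(y)` with a constant `C_ρ` free to blow up as `ρ → 1⁻` (the denominators of a tempered,
`𝓗₁`-valued class), and outside a finite set of primes allowed to depend on `ρ`. This file proves that such an output is already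
stub A's divisibility: it combines the values link (p631301), the index principle (p628183), continuity of the values of
`R₀⟦T⟧` on closed balls and the density of `ℚ̄_p` in `ℂ_p` (to pass from algebraic to all points), and g4's tempered domination
lemma (p624927, `…UnrSeriesTemperedDomination.exists_C_pow_mul_mem_span_of_norm_value_le_on_closedBalls`).

* `continuousOn_tsum_closedBall` — the value function of `L ∈ R₀⟦T⟧` is continuous on every closed ball of radius `< 1`;
* `norm_value_le_on_closedBall_of_algebraic` — domination `‖L‖ ≤ C‖g‖` at the ALGEBRAIC points of a closed ball off a finite set
  extends to all its points off that set;
* `exists_C_pow_mul_mem_span_of_norm_value_le_on_closedBalls_algebraic` — g4's tempered lemma with algebraic points only;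
* **`exists_C_pow_mul_mem_span_of_card_quotSMulTop_le_tempered`** — N f.g. torsion, `char N = (g₀) ≠ 0`, `L ∈ R₀⟦T⟧`: if for every
  `ρ < 1` there are `C_ρ` and `a_ρ ≠ 0` with `#(N ⧸ Q N) · ‖L(y)‖^{deg Q} ≤ p^{C_ρ · deg Q}` for every distinguished irreducible `Q`
  prime to `g₀ a_ρ` and every root `y` of `Q` with `‖y‖ ≤ ρ`, then `∃ μ, p^μ · L ∈ (g₀ · R₀⟦T⟧)`.

HONEST FRAMING: pure algebra/analysis; the tempered index bound is a hypothesis — the research content of crux 26896 in the currency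
a tempered Kolyvagin-system argument produces. K1 = A + print stays open; BSD is not proved by any of this.
-/

set_option linter.dupNamespace false
set_option autoImplicit false

noncomputable section

open scoped Classical Polynomial Topology
open Filter Literature.NumberTheory.EllipticCurves Literature.NumberTheory.EllipticCurves.IwasawaAlgebra
  Summit.BirchSwinnertonDyer.Rank1Residual.X11b.Halves
  Summit.BirchSwinnertonDyer.BirchSwinnertonDyer.Theorems.CumulativeHeegnerInclusionAtThreeUnrSeriesDomination
  Summit.BirchSwinnertonDyer.BirchSwinnertonDyer.Theorems.CumulativeHeegnerInclusionAtThreeUnrSeriesZeros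
  Summit.BirchSwinnertonDyer.BirchSwinnertonDyer.Theorems.CongruentShaFreeCutBDPUpToPowerMapIdentity
  Summit.BirchSwinnertonDyer.BirchSwinnertonDyer.Theorems.CumulativeHeegnerInclusionAtThreeSpecialisationValues

namespace Summit.BirchSwinnertonDyer.BirchSwinnertonDyer.Theorems.CumulativeHeegnerInclusionAtThreeSpecialisationValuesTempered

variable {p : ℕ} [Fact p.Prime]

/-! ### §1 Continuity of values on closed balls and the passage from algebraic to all points -/

/-- **The value function of `L ∈ R₀⟦T⟧` is continuous on every closed ball `‖x‖ ≤ ρ` with `ρ < 1`** (uniform convergence: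
the `k`-th term has norm `≤ ρ^k`). -/
theorem continuousOn_tsum_closedBall (L : UnrSeries p) {ρ : ℝ} (hρ : ρ < 1) :
    ContinuousOn (fun x : ℂ_[p] => ∑' k : ℕ, ((PowerSeries.coeff k L : unrIntegers p) : ℂ_[p]) * x ^ k)
      (Metric.closedBall 0 ρ) := by
  refine continuousOn_tsum (u := fun k : ℕ => (max ρ 0) ^ k) (fun k => ?_) ?_ ?_
  · exact (continuous_const.mul (continuous_pow k)).continuousOn
  · exact summable_geometric_of_lt_one (le_max_right _ _) (max_lt hρ one_pos)
  · intro k x hx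
    rw [Metric.mem_closedBall, dist_zero_right] at hx
    exact (norm_coeff_mul_pow_le L x k).trans (pow_le_pow_left₀ (norm_nonneg _) (hx.trans (le_max_left _ _)) k)

/-- **Domination at the algebraic points of a closed ball extends to all its points.** If `‖L(y)‖ ≤ C · ‖g(y)‖` for every
`y ∈ ℚ̄_p` with `‖y‖ ≤ ρ` (`ρ < 1`) outside a finite `F`, then the same holds at every `x ∈ ℂ_p` with `‖x‖ ≤ ρ`, `x ∉ F`
(values are continuous on the ball; `ℚ̄_p ∖ F` is dense in `ℂ_p`; in the ultrametric `ℂ_p` the algebraic points near `x ≠ 0`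
have norm `≤ ‖x‖`). -/
theorem norm_value_le_on_closedBall_of_algebraic {g L : UnrSeries p} {ρ C : ℝ} (hρ : ρ < 1) {F : Set ℂ_[p]}
    (hF : F.Finite)
    (hdom : ∀ y : PadicAlgCl p, (y : ℂ_[p]) ∉ F → ‖(y : ℂ_[p])‖ ≤ ρ → ∀ u v : ℂ_[p],
      g.HasValueAt (y : ℂ_[p]) u → L.HasValueAt (y : ℂ_[p]) v → ‖v‖ ≤ C * ‖u‖) :
    ∀ x : ℂ_[p], x ∉ F → ‖x‖ ≤ ρ → ∀ u v : ℂ_[p], g.HasValueAt x u → L.HasValueAt x v → ‖v‖ ≤ C * ‖u‖ := by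
  intro x hxF hxρ u v hu hv
  have hx1 : ‖x‖ < 1 := lt_of_le_of_lt hxρ hρ
  set Vg : ℂ_[p] → ℂ_[p] := fun z => ∑' k : ℕ, ((PowerSeries.coeff k g : unrIntegers p) : ℂ_[p]) * z ^ k with hVg
  set VL : ℂ_[p] → ℂ_[p] := fun z => ∑' k : ℕ, ((PowerSeries.coeff k L : unrIntegers p) : ℂ_[p]) * z ^ k with hVL
  have hu' : u = Vg x := hu.unique (hasValueAt_tsum g hx1)
  have hv' : v = VL x := hv.unique (hasValueAt_tsum L hx1)
  -- the algebraic points of the ball off `F`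
  set s : Set ℂ_[p] := {y | ‖y‖ ≤ ρ ∧ y ∈ Set.range ((↑) : PadicAlgCl p → ℂ_[p]) \ F} with hs
  have hs1 : ∀ y ∈ s, ‖VL y‖ ≤ C * ‖Vg y‖ := by
    rintro y ⟨hyρ, ⟨z, rfl⟩, hyF⟩
    have hz1 : ‖(z : ℂ_[p])‖ < 1 := lt_of_le_of_lt hyρ hρ
    exact hdom z hyF hyρ _ _ (hasValueAt_tsum g hz1) (hasValueAt_tsum L hz1)
  have hsub : s ⊆ Metric.closedBall 0 ρ := fun y hy => by
    rw [Metric.mem_closedBall, dist_zero_right]; exact hy.1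
  have hclos : closure s ⊆ Metric.closedBall 0 ρ := closure_minimal hsub Metric.isClosed_closedBall
  have hcL : ContinuousOn (fun y => ‖VL y‖) (closure s) := ((continuousOn_tsum_closedBall L hρ).mono hclos).norm
  have hcg : ContinuousOn (fun y => C * ‖Vg y‖) (closure s) :=
    continuousOn_const.mul ((continuousOn_tsum_closedBall g hρ).mono hclos).norm
  -- `x` lies in the closure of `s`
  have hxcl : x ∈ closure s := by
    by_cases hx0 : x = 0
    · refine subset_closure ⟨hxρ, ⟨0, ?_⟩, hxF⟩
      rw [hx0]; exact PadicComplex.coe_zero p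
    · -- the open neighbourhood `‖y - x‖ < ‖x‖` of `x`, on which `‖y‖ ≤ ‖x‖ ≤ ρ`
      have hxpos : 0 < ‖x‖ := norm_pos_iff.mpr hx0
      set U : Set ℂ_[p] := Metric.ball x ‖x‖ with hU
      have hUo : IsOpen U := Metric.isOpen_ball
      have hxU : x ∈ U := Metric.mem_ball_self hxpos
      have ht :=
        Summit.BirchSwinnertonDyer.BirchSwinnertonDyer.Theorems.CumulativeHeegnerInclusionAtThreeUnrSeriesTadicPin.mem_closure_disc_algebraic_diff_finite
          hF hx1
      have h1 : x ∈ closure (U ∩ {y : ℂ_[p] | ‖y‖ < 1 ∧ y ∈ Set.range ((↑) : PadicAlgCl p → ℂ_[p]) \ F}) :=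
        hUo.inter_closure ⟨hxU, ht⟩
      refine closure_mono ?_ h1
      rintro y ⟨hyU, -, hyalg⟩
      refine ⟨?_, hyalg⟩
      rw [hU, Metric.mem_ball, dist_eq_norm] at hyU
      have h2 : ‖y‖ ≤ max ‖y - x‖ ‖x‖ := by
        have := IsUltrametricDist.norm_add_le_max (y - x) x
        rwa [sub_add_cancel] at this
      exact h2.trans ((max_le hyU.le le_rfl).trans hxρ)
  have hfin := le_on_closure hs1 hcL hcg hxcl
  rw [hu', hv']
  exact hfin

/-- **g4's tempered domination lemma with ALGEBRAIC points only**: if for every `ρ < 1` there are a finite `F_ρ` and `C_ρ`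
with `‖L(y)‖ ≤ C_ρ · ‖g(y)‖` for every algebraic `y` with `‖y‖ ≤ ρ`, `y ∉ F_ρ`, then `p^μ · L ∈ (g)` for some `μ`. -/
theorem exists_C_pow_mul_mem_span_of_norm_value_le_on_closedBalls_algebraic {g L : UnrSeries p} (hg : g ≠ 0)
    (hdom : ∀ ρ : ℝ, ρ < 1 → ∃ (F : Set ℂ_[p]) (C : ℝ), F.Finite ∧
      ∀ y : PadicAlgCl p, (y : ℂ_[p]) ∉ F → ‖(y : ℂ_[p])‖ ≤ ρ → ∀ u v : ℂ_[p],
        g.HasValueAt (y : ℂ_[p]) u → L.HasValueAt (y : ℂ_[p]) v → ‖v‖ ≤ C * ‖u‖) :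
    ∃ μ : ℕ, PowerSeries.C (((p : ℕ) : unrIntegers p) ^ μ) * L ∈ Ideal.span {g} := by
  refine Summit.BirchSwinnertonDyer.BirchSwinnertonDyer.Theorems.CumulativeHeegnerInclusionAtThreeUnrSeriesTemperedDomination.exists_C_pow_mul_mem_span_of_norm_value_le_on_closedBalls
    hg fun ρ hρ => ?_
  obtain ⟨F, C, hF, h⟩ := hdom ρ hρ
  exact ⟨F, C, hF, norm_value_le_on_closedBall_of_algebraic hρ hF h⟩

/-! ### §2 The tempered index-currency transfer -/

/-- **From TEMPERED INDEX currency to stub A's currency.** Let `N` be a finitely generated torsion `Λ`-module with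
`char N = (g₀)`, `g₀ ≠ 0`, and `L ∈ R₀⟦T⟧`. Suppose that for every radius `ρ < 1` there are `C_ρ ∈ ℕ` and `a_ρ ∈ Λ ∖ {0}` such
that for every distinguished irreducible `Q ∈ ℤ_p[T]` prime to `g₀` and to `a_ρ`, every root `y ∈ ℚ̄_p` of `Q` with `‖y‖ ≤ ρ`
and the value `v = L(y)`: `#(N ⧸ Q N) · ‖v‖^{deg Q} ≤ p^{C_ρ · deg Q}` — a Kolyvagin-system bound at the INTERIOR height-one primes,
with radius-dependent constant and finite exceptional set (the format of a tempered, `𝓗₁`-valued class; memo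
TEMPERED-LINE-VIABILITY-g4 (d♮)). Then `p^μ · L ∈ (g₀ · R₀⟦T⟧)` for some `μ`. -/
theorem exists_C_pow_mul_mem_span_of_card_quotSMulTop_le_tempered (N : Type*) [AddCommGroup N]
    [Module (IwasawaAlgebra p) N] [Module.Finite (IwasawaAlgebra p) N]
    (hN : Module.IsTorsion (IwasawaAlgebra p) N) {g₀ : IwasawaAlgebra p}
    (hg₀ : Module.charIdeal (IwasawaAlgebra p) N = Ideal.span {g₀}) (hg0 : g₀ ≠ 0) {L : UnrSeries p}
    (hKS : ∀ ρ : ℝ, ρ < 1 → ∃ (C : ℕ) (a : IwasawaAlgebra p), a ≠ 0 ∧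
      ∀ Q : ℤ_[p][X], Q.IsDistinguishedAt (IsLocalRing.maximalIdeal ℤ_[p]) → Irreducible Q →
      IsRelPrime g₀ (Q : IwasawaAlgebra p) → IsRelPrime a (Q : IwasawaAlgebra p) →
      ∀ y : PadicAlgCl p, Polynomial.aeval y (Q.map (algebraMap ℤ_[p] ℚ_[p])) = 0 → ‖(y : ℂ_[p])‖ ≤ ρ →
      ∀ v : ℂ_[p], L.HasValueAt (y : ℂ_[p]) v →
        (Nat.card (N ⧸ (Ideal.span {(Q : IwasawaAlgebra p)} • ⊤ : Submodule (IwasawaAlgebra p) N)) : ℝ) *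
          ‖v‖ ^ Q.natDegree ≤ (p : ℝ) ^ (C * Q.natDegree)) :
    ∃ μ : ℕ, PowerSeries.C (((p : ℕ) : unrIntegers p) ^ μ) * L ∈
      Ideal.span {PowerSeries.map (toUnr p) g₀} := by
  have hp : p.Prime := Fact.out
  set g : UnrSeries p := PowerSeries.map (toUnr p) g₀ with hgdef
  have hg : g ≠ 0 := map_toUnr_ne_zero hg0
  obtain ⟨B, hB, hbd⟩ := exists_card_quotSMulTop_bounds_of_isRelPrime p N hN
  refine exists_C_pow_mul_mem_span_of_norm_value_le_on_closedBalls_algebraic hg fun ρ hρ => ?_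
  obtain ⟨C, a, ha, hC⟩ := hKS ρ hρ
  -- exceptional points: the zeros of `g₀ · a` in the open disc
  have hga : PowerSeries.map (toUnr p) (g₀ * a) ≠ 0 := map_toUnr_ne_zero (mul_ne_zero hg0 ha)
  have hF : {z : ℂ_[p] | ‖z‖ < 1 ∧ UnrSeries.HasValueAt (PowerSeries.map (toUnr p) (g₀ * a)) z 0}.Finite :=
    finite_zeros hga
  refine ⟨_, (B : ℝ) * (p : ℝ) ^ C, hF, fun y hyF hyρ u v hu hv => ?_⟩
  have hy1 : ‖(y : ℂ_[p])‖ < 1 := lt_of_le_of_lt hyρ hρ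
  have hy1' : ‖y‖ < 1 := by rwa [PadicComplex.norm_extends] at hy1
  obtain ⟨Q, hQ, hirr, hyQ⟩ := exists_isDistinguishedAt_irreducible_of_norm_lt_one hy1'
  have hd : 0 < Q.natDegree := natDegree_pos_of_irreducible p hQ hirr
  obtain ⟨w, hw⟩ := exists_hasValueAt (PowerSeries.map (toUnr p) a) hy1
  have huw : u * w ≠ 0 := by
    intro h0
    have hmul : UnrSeries.HasValueAt (PowerSeries.map (toUnr p) (g₀ * a)) (y : ℂ_[p]) (u * w) := by
      rw [map_mul]; exact hasValueAt_mul hy1 hu hw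
    exact hyF ⟨hy1, h0 ▸ hmul⟩
  have hu0 : u ≠ 0 := left_ne_zero_of_mul huw
  have hw0 : w ≠ 0 := right_ne_zero_of_mul huw
  have hndvd : ∀ {b : IwasawaAlgebra p} {z : ℂ_[p]},
      UnrSeries.HasValueAt (PowerSeries.map (toUnr p) b) (y : ℂ_[p]) z → z ≠ 0 →
        IsRelPrime b (Q : IwasawaAlgebra p) := by
    intro b z hz hz0
    refine ((prime_coe_of_irreducible p hQ hirr).irreducible.isRelPrime_iff_not_dvd.mpr ?_).symm
    rintro ⟨k, hk⟩
    have hmem : b - ((0 : ℤ_[p][X]) : IwasawaAlgebra p) ∈ Ideal.span {(Q : IwasawaAlgebra p)} := by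
      rw [Polynomial.coe_zero, sub_zero, hk]
      exact Ideal.mul_mem_right _ _ (Ideal.mem_span_singleton_self _)
    have h0 := value_eq_eval_of_sub_mem hQ hyQ hmem hz
    rw [Polynomial.map_zero, Polynomial.eval_zero] at h0
    exact hz0 h0
  have hcop : IsRelPrime g₀ (Q : IwasawaAlgebra p) := hndvd hu hu0
  have hcopa : IsRelPrime a (Q : IwasawaAlgebra p) := hndvd hw hw0
  have hlink := card_quotient_mul_norm_value_pow_eq_one hQ hirr hcop hyQ hu
  obtain ⟨-, h1, -⟩ := hbd Q hQ g₀ hg₀ hcop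
  rw [hg₀] at h1
  have h2 := hC Q hQ hirr hcop hcopa y hyQ hyρ v hv
  set d := Q.natDegree with hddef
  set c₁ : ℝ := ((Nat.card (IwasawaAlgebra p ⧸ (Ideal.span {(Q : IwasawaAlgebra p)} ⊔ Ideal.span {g₀})) : ℕ) : ℝ)
    with hc₁
  set c₂ : ℝ := ((Nat.card (N ⧸ (Ideal.span {(Q : IwasawaAlgebra p)} • ⊤ : Submodule (IwasawaAlgebra p) N)) : ℕ) : ℝ)
    with hc₂
  have h1' : c₁ ≤ B * c₂ := by rw [hc₁, hc₂]; exact_mod_cast h1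
  have hB1 : (1 : ℝ) ≤ B := by exact_mod_cast hB
  have hc₂0 : 0 ≤ c₂ := by rw [hc₂]; exact Nat.cast_nonneg _
  have hpow : ‖v‖ ^ d ≤ ((B : ℝ) * (p : ℝ) ^ C * ‖u‖) ^ d := by
    calc ‖v‖ ^ d = ‖v‖ ^ d * (c₁ * ‖u‖ ^ d) := by rw [hlink, mul_one]
      _ ≤ ‖v‖ ^ d * (B * c₂ * ‖u‖ ^ d) := by gcongr
      _ = B * (c₂ * ‖v‖ ^ d) * ‖u‖ ^ d := by ring
      _ ≤ B * (p : ℝ) ^ (C * d) * ‖u‖ ^ d := by gcongr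
      _ ≤ (B : ℝ) ^ d * ((p : ℝ) ^ C) ^ d * ‖u‖ ^ d := by
          rw [← pow_mul]
          gcongr
          exact le_self_pow₀ hB1 hd.ne'
      _ = ((B : ℝ) * (p : ℝ) ^ C * ‖u‖) ^ d := by ring
  exact (pow_le_pow_iff_left₀ (norm_nonneg _) (by positivity) hd.ne').mp hpow

end Summit.BirchSwinnertonDyer.BirchSwinnertonDyer.Theorems.CumulativeHeegnerInclusionAtThreeSpecialisationValuesTempered

end
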